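import Literature.Analysis.FluidPDE.TaoQuantitativeLocalDuhamel
import Literature.Analysis.FluidPDE.TaoQuantitativeLowPassBlocks
import Literature.Analysis.FluidPDE.LittlewoodPaleyBlockFn
import HarnessLib

/-!
# Tao 2021, Prop. 3.1 (iv): the low-pass projection at a point

Analysis/FluidPDE proof file (theorems only, no named facts), step 8j-1 of the inline
programme for `Literature.Analysis.FluidPDE.tao_quantitative_ess` (Tao 2021, Thm. 1.2).

In the corrected back-propagation argument (S. Palasek, ARMA 242 (2021), proof of Prop. 6,
read at `q = 3`: "`∑_{N₁ ≲ N} … (∑_{N₁ ≤ A₂^{-1}} A N₁ + ∑_{A₂^{-1} ≤ N₁ ≲ N} A₁^{-1}N₁)`",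
replacing the local `L^{3/2}` claim for `P_{≤N/100}u` on p. 17 of T. Tao, arXiv:1908.04958v2)
the low-frequency factor `P_{≤N/100}u = g_κ ⋆ u` of the "low-high" paraproducts is measured in
`L^∞` on the ball, block by block: its value at a point is the sum over the blocks `j' ≤ m+1`
of `(g_κ ⋆ Δ̇_{j'}u)(x)`, and each of these is controlled by the supremum of `Δ̇_{j'}u` on a
neighbouring ball (the contradiction hypothesis `A₁^{-1}N'` or the pointwise bound (3.2) `AN'`)
plus a tail. This file provides the two pointwise tools:

* `norm_lowPass_apply_le` — **the low-pass projection at a point from a local supremum**: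
  `‖(g_κ ⋆ v)(x)‖ ≤ ‖g₁‖₁ sup_{B(x,ρ)}‖v‖ + ρ^{-2}κ^{-2}M₂ sup‖v‖`;
* `lowPass_apply_sum_blockFn`, `enorm_lowPass_apply_le_tsum` — **the low-pass projection at a
  point is dominated by the sum of the low-pass projections of the blocks**:
  `‖(g_κ ⋆ u)(x)‖ ≤ ∑_{j'} ‖(g_κ ⋆ Δ̇_{j'}u)(x)‖` for `u ∈ L²` (the `L²` Littlewood–Paley
  partition `tendsto_eLpNorm_sub_sum_blockFn` and the continuity of `v ↦ (g_κ ⋆ v)(x)` on `L²`);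
* `enorm_lowPass_apply_le_tsum_Iic` — for `κ = 2^{m+2}` and bounded `u` only the blocks
  `j' ≤ m + 1` contribute (`Δ̇_{j'}(g_κ ⋆ u) = 0` for `j' ≥ m+2`).

## References

* T. Tao, arXiv:1908.04958v2 (2021), Prop. 3.1 (iv) proof pp. 16–18; §2 p. 7 (`P_{≤N}`).
  [Tao2021QuantitativeNS]
* S. Palasek, ARMA 242 (2021), proof of Prop. 6. [Palasek2021]
-/

noncomputable section

open MeasureTheory Set Function Filter Topology Metric
open scoped ENNReal NNReal RealInnerProductSpace Convolution

namespace Literature.Analysis.FluidPDE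

open Literature.Analysis.FunctionSpaces (blockFn blockKernel)
open Literature.Analysis.Fourier (lowPassKernel lowPassMass lowPassMoment)

variable {E : Type*} [NormedAddCommGroup E] [InnerProductSpace ℝ E] [FiniteDimensional ℝ E]
  [MeasurableSpace E] [BorelSpace E]

/-! ## The low-pass projection at a point from a local supremum -/

/-- **The low-pass projection at a point from a local supremum**: for `κ, ρ > 0`, a field `v`
with `‖v‖ ≤ S` on `B(x, ρ)` and `‖v‖ ≤ M` everywhere (`S, M ≥ 0`),
`‖(g_κ ⋆ v)(x)‖ ≤ ‖g₁‖_{L¹} S + ρ^{-2}κ^{-2} M₂ M` (`M₂ = ∫‖x‖²|g₁|`): the convolution integral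
split at `‖t‖ = ρ`, the second-moment tail of `g_κ`. [cite: Tao2021QuantitativeNS, Lemma 2.1 (2.2) p. 8] -/
theorem norm_lowPass_apply_le {κ ρ : ℝ} (hκ : 0 < κ) (hρ : 0 < ρ) {F : Type*}
    [NormedAddCommGroup F] [NormedSpace ℝ F] {v : E → F} {x : E} {S M : ℝ} (hS : 0 ≤ S)
    (hM : 0 ≤ M) (hloc : ∀ y ∈ ball x ρ, ‖v y‖ ≤ S) (hglob : ∀ y, ‖v y‖ ≤ M) :
    ‖(lowPassKernel E κ ⋆[ContinuousLinearMap.lsmul ℝ ℝ, volume] v) x‖ ≤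
      lowPassMass E * S + (ρ ^ 2)⁻¹ * ((κ ^ 2)⁻¹ * lowPassMoment E) * M := by
  rw [convolution_lsmul]
  -- the integrand bound
  have hpt : ∀ t, ‖lowPassKernel E κ t • v (x - t)‖ ≤
      S * ‖lowPassKernel E κ t‖ + M * ‖(ball (0 : E) ρ)ᶜ.indicator (lowPassKernel E κ) t‖ := by
    intro t
    rw [norm_smul]
    by_cases ht : t ∈ ball (0 : E) ρ
    · have hxt : x - t ∈ ball x ρ := by
        rw [mem_ball, dist_eq_norm, sub_sub_cancel_left, norm_neg]; exact mem_ball_zero_iff.1 ht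
      calc ‖lowPassKernel E κ t‖ * ‖v (x - t)‖ ≤ ‖lowPassKernel E κ t‖ * S :=
            mul_le_mul_of_nonneg_left (hloc _ hxt) (norm_nonneg _)
        _ ≤ S * ‖lowPassKernel E κ t‖ + M * ‖(ball (0 : E) ρ)ᶜ.indicator (lowPassKernel E κ) t‖ := by
            rw [mul_comm]; exact le_add_of_nonneg_right (by positivity)
    · rw [indicator_of_mem (mem_compl ht)]
      calc ‖lowPassKernel E κ t‖ * ‖v (x - t)‖ ≤ ‖lowPassKernel E κ t‖ * M :=
            mul_le_mul_of_nonneg_left (hglob _) (norm_nonneg _)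
        _ ≤ S * ‖lowPassKernel E κ t‖ + M * ‖lowPassKernel E κ t‖ := by
            rw [mul_comm]; exact le_add_of_nonneg_left (by positivity)
  have hgi : Integrable (lowPassKernel E κ) := Fourier.integrable_lowPassKernel hκ
  have hfi : Integrable (fun t => S * ‖lowPassKernel E κ t‖ +
      M * ‖(ball (0 : E) ρ)ᶜ.indicator (lowPassKernel E κ) t‖) :=
    (hgi.norm.const_mul S).add ((hgi.indicator measurableSet_ball.compl).norm.const_mul M)
  refine (norm_integral_le_integral_norm _).trans ((integral_mono_of_nonneg
    (Eventually.of_forall fun t => norm_nonneg _) hfi (Eventually.of_forall hpt)).trans ?_)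
  rw [integral_add (hgi.norm.const_mul S) ((hgi.indicator measurableSet_ball.compl).norm.const_mul M),
    integral_const_mul, integral_const_mul]
  -- the mass and the tail
  have hmass : ∫ t, ‖lowPassKernel E κ t‖ = lowPassMass E := by
    rw [← Fourier.integral_abs_lowPassKernel (E := E) hκ]; rfl
  have htail : ∫ t, ‖(ball (0 : E) ρ)ᶜ.indicator (lowPassKernel E κ) t‖ ≤
      (ρ ^ 2)⁻¹ * ((κ ^ 2)⁻¹ * lowPassMoment E) := by
    rw [integral_norm_eq_lintegral_enorm (hgi.indicator measurableSet_ball.compl).aestronglyMeasurable]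
    have hM₂ := Fourier.lowPassMoment_nonneg (E := E)
    refine ENNReal.toReal_le_of_le_ofReal (by positivity) ?_
    exact lintegral_enorm_lowPassKernel_far_le hκ hρ
  rw [hmass]
  calc S * lowPassMass E + M * ∫ t, ‖(ball (0 : E) ρ)ᶜ.indicator (lowPassKernel E κ) t‖
      ≤ S * lowPassMass E + M * ((ρ ^ 2)⁻¹ * ((κ ^ 2)⁻¹ * lowPassMoment E)) := by gcongr
    _ = lowPassMass E * S + (ρ ^ 2)⁻¹ * ((κ ^ 2)⁻¹ * lowPassMoment E) * M := by ring

/-! ## The low-pass projection at a point as a sum over blocks -/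

/-- The low-pass projection of a finite sum of `L²` fields, at a point. [folklore] -/
theorem lowPass_apply_finsetSum {κ : ℝ} (hκ : 0 < κ) {F : Type*} [NormedAddCommGroup F]
    [NormedSpace ℝ F] [CompleteSpace F] {ι' : Type*} (s : Finset ι') {f : ι' → E → F}
    (hf : ∀ i ∈ s, MemLp (f i) 2 volume) (x : E) :
    (lowPassKernel E κ ⋆[ContinuousLinearMap.lsmul ℝ ℝ, volume] (∑ i ∈ s, f i)) x =
      ∑ i ∈ s, (lowPassKernel E κ ⋆[ContinuousLinearMap.lsmul ℝ ℝ, volume] f i) x := by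
  haveI : Fact ((1 : ℝ≥0∞) ≤ 2) := ⟨one_le_two⟩
  simp only [convolution_lsmul, Finset.sum_apply, Finset.smul_sum]
  rw [integral_finsetSum _ fun i hi => integrable_lowPassKernel_smul_sub hκ (hf i hi) x]

/-- **The low-pass projection at a point is dominated by the sum over the blocks**: for
`u ∈ L²(E; ℝ^ι)`, `κ > 0` and every `x`,
`‖(g_κ ⋆ u)(x)‖ ≤ ∑_{j' ∈ ℤ} ‖(g_κ ⋆ Δ̇_{j'}u)(x)‖` — the symmetric partial sums of the blocks
converge to `u` in `L²` (`tendsto_eLpNorm_sub_sum_blockFn`) and `v ↦ (g_κ ⋆ v)(x)` is `L²`-continuous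
(`|(g_κ ⋆ v)(x)| ≤ ‖g_κ‖₂‖v‖₂`). [cite: Tao2021QuantitativeNS, §2 p. 7] -/
theorem enorm_lowPass_apply_le_tsum [Nontrivial E] {ι : Type*} [Fintype ι]
    {u : E → EuclideanSpace ℝ ι} (hu : MemLp u 2 volume) {κ : ℝ} (hκ : 0 < κ) (x : E) :
    ‖(lowPassKernel E κ ⋆[ContinuousLinearMap.lsmul ℝ ℝ, volume] u) x‖ₑ ≤
      ∑' j : ℤ, ‖(lowPassKernel E κ ⋆[ContinuousLinearMap.lsmul ℝ ℝ, volume] blockFn j u) x‖ₑ := by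
  haveI : Fact ((1 : ℝ≥0∞) ≤ 2) := ⟨one_le_two⟩
  have hg := memLp_lowPassKernel (E := E) hκ 2
  -- the partial sums
  obtain ⟨P, hP⟩ : ∃ P : ℕ → E → EuclideanSpace ℝ ι,
      P = fun n : ℕ => ∑ j ∈ Finset.Icc (-(n : ℤ)) (n : ℤ), blockFn j u := ⟨_, rfl⟩
  have hPL : ∀ n, MemLp (P n) 2 volume := fun n => by
    rw [hP]; exact memLp_finsetSum' _ fun j _ => FunctionSpaces.memLp_blockFn j hu one_le_two
  have hconv : Tendsto (fun n => eLpNorm (u - P n) 2 volume) atTop (𝓝 0) := by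
    rw [hP]; exact tendsto_eLpNorm_sub_sum_blockFn (ι := ι) hu
  -- continuity of `v ↦ (g ⋆ v)(x)` on `L²`
  have hdiff : ∀ n, ‖(lowPassKernel E κ ⋆[ContinuousLinearMap.lsmul ℝ ℝ, volume] P n) x -
      (lowPassKernel E κ ⋆[ContinuousLinearMap.lsmul ℝ ℝ, volume] u) x‖ₑ ≤
      eLpNorm (lowPassKernel E κ) 2 volume * eLpNorm (u - P n) 2 volume := by
    intro n
    have hsub := lowPass_sub (E := E) hκ (hPL n) hu
    have heq : (lowPassKernel E κ ⋆[ContinuousLinearMap.lsmul ℝ ℝ, volume] P n) x -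
        (lowPassKernel E κ ⋆[ContinuousLinearMap.lsmul ℝ ℝ, volume] u) x =
        (lowPassKernel E κ ⋆[ContinuousLinearMap.lsmul ℝ ℝ, volume] (P n - u)) x := by
      rw [hsub, Pi.sub_apply]
    rw [heq, eLpNorm_sub_comm]
    exact FunctionSpaces.enorm_convolution_smul_le_eLpNorm_mul hg.1 ((hPL n).sub hu).1 2 2 x
  have hlim : Tendsto (fun n => (lowPassKernel E κ ⋆[ContinuousLinearMap.lsmul ℝ ℝ, volume] P n) x)
      atTop (𝓝 ((lowPassKernel E κ ⋆[ContinuousLinearMap.lsmul ℝ ℝ, volume] u) x)) := by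
    rw [tendsto_iff_edist_tendsto_0]
    have h0 : Tendsto (fun n => eLpNorm (lowPassKernel E κ) 2 volume * eLpNorm (u - P n) 2 volume)
        atTop (𝓝 0) := by
      have h := ENNReal.Tendsto.const_mul hconv (Or.inr hg.eLpNorm_ne_top)
      rwa [mul_zero] at h
    refine tendsto_of_tendsto_of_tendsto_of_le_of_le tendsto_const_nhds h0 (fun n => bot_le)
      fun n => ?_
    rw [edist_eq_enorm_sub]
    exact hdiff n
  -- each partial sum is dominated by the full sum
  refine le_of_tendsto' hlim.enorm fun n => ?_
  rw [hP]
  simp only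
  rw [lowPass_apply_finsetSum hκ _ (fun j _ => FunctionSpaces.memLp_blockFn j hu one_le_two) x]
  exact (enorm_sum_le _ _).trans (ENNReal.sum_le_tsum _)

/-- **Only the blocks `j' ≤ m + 1` contribute** (`κ = 2^{m+2}`): for a bounded a.e.-strongly
measurable `u ∈ L²(E; ℝ^ι)` and every `x`,
`‖(g_κ ⋆ u)(x)‖ ≤ ∑_{j' ≤ m+1} ‖(g_κ ⋆ Δ̇_{j'}u)(x)‖`, since `g_κ ⋆ Δ̇_{j'}u = Δ̇_{j'}(g_κ ⋆ u) = 0`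
for `j' ≥ m + 2`. [cite: Tao2021QuantitativeNS, §2 p. 7] -/
theorem enorm_lowPass_apply_le_tsum_Iic [Nontrivial E] {ι : Type*} [Fintype ι]
    {u : E → EuclideanSpace ℝ ι} (hu : MemLp u 2 volume) (hum : AEStronglyMeasurable u volume)
    {Mu : ℝ} (hMu : ∀ y, ‖u y‖ ≤ Mu) (m : ℤ) (x : E) :
    ‖(lowPassKernel E ((2 : ℝ) ^ (m + 2)) ⋆[ContinuousLinearMap.lsmul ℝ ℝ, volume] u) x‖ₑ ≤
      ∑' j : ℤ, (Set.Iic (m + 1)).indicator (fun j => ‖(lowPassKernel E ((2 : ℝ) ^ (m + 2))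
        ⋆[ContinuousLinearMap.lsmul ℝ ℝ, volume] blockFn j u) x‖ₑ) j := by
  have hκ : (0 : ℝ) < (2 : ℝ) ^ (m + 2) := zpow_pos two_pos _
  refine (enorm_lowPass_apply_le_tsum hu hκ x).trans (le_of_eq (tsum_congr fun j => ?_))
  by_cases hj : j ≤ m + 1
  · rw [indicator_of_mem (mem_Iic.2 hj)]
  · rw [indicator_of_notMem (fun h => hj (mem_Iic.1 h))]
    have hzero : lowPassKernel E ((2 : ℝ) ^ (m + 2)) ⋆[ContinuousLinearMap.lsmul ℝ ℝ, volume]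
        blockFn j u = 0 := by
      rw [← blockFn_lowPass_comm j hκ hum hMu, blockFn_lowPass_eq_zero_euclidean (by omega) hu]
    rw [hzero, Pi.zero_apply, enorm_zero]

end Literature.Analysis.FluidPDE
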